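/-
Origin: expansion seat `planner-pub-hodgecm-pv01-0`, handover 2026-08-18T03:57:15Z (`HOME/pub-hodgecm-pv01/lean/Pv01/SatakeConj.lean`, md5 56c4d4ef, 75 lines);
landed by the gen-5 packager in gate run 20 as `HodgeCM/PerL34/SatakeConj.lean` (import ^import Pv01\.→import HodgeCM.PerL34. ×1).
-/
/-
Origin: HOME/pub-hodgecm-pv01/lean/Pv01/SatakeConj.lean (module `Pv01.SatakeConj`; the packager renames to
`HodgeCM.PerL34.SatakeConj` and the import below to `HodgeCM.PerL34.SatakeMultiset`) — session
planner-pub-hodgecm-pv01-0 (unit pub-hodgecm-pv01, DAG-NODE PROVER #01).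
DAG node (HOME/LEMMAS.md v2 §1): N02 (PerL v5 §1.4 "Inputs from [Y1neg]", tex ll. 88–113) — SUPPORT #3: the whole
vocabulary-free core of [Y1neg] v2 (eq:satconj) (ll. 82–86) + Lemma 5.2 (ll. 166–172): a ring endomorphism of `ℂ`
fixing the coefficients of the Hecke polynomial fixes the Satake parameter `y` of absolute value `q^{1/2}`; used in
HOME/GAPS.md entries pv01-G1 (link (E3)) and pv01-G1e (i) (`ℚ(a) ∋ μ_w(ϖ_w) q_w^{1/2}`).  Pure Mathlib.
-/
import Summits.HodgeConjecture.HodgeCM.PerL34.SatakeMultiset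

set_option autoImplicit false

/-!
# Galois invariance of the middle Satake parameter ([Y1neg] (eq:satconj) + Lemma 5.2)

[Y1neg] v2 ll. 82–86 (VERBATIM): "if `\tau\in\mathrm{Aut}(\C)` and `P_{T}(X)\in T'[X]` is the Hecke polynomial at `w`
(whose roots, suitably normalised by half-integral powers of `q_w` which `\tau` fixes, give `\mathrm{Sat}_w(a)`), then
the Hecke polynomial of `a^\tau` is `P_T^\tau`, so `\mathrm{Sat}_w(a^\tau)=\tau(\mathrm{Sat}_w(a))` (as multisets, `\tau`
acting on `\C`)."  Together with the multiset step of Lemma 5.2 (`SatakeMultiset.eq_of_mem_of_div_mem`) this gives: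

* `mem_roots_of_map_eq` — if `p.map σ = p` then `σ` maps roots of `p` to roots of `p` (for an injective ring
  endomorphism `σ` of `ℂ`; `ℂ` is algebraically closed, so `p` has `natDegree p` roots);
* `fixes_middle_param` — if moreover `p.roots = {x, y, y/q}` with `‖x‖ = 1`, `‖y‖ = √q`, `q > 1` a natural number
  (so `σ q = q`), then `σ y = y`.

In PerL / [Y1neg] this is applied (a) with `σ = τ` and `p` = the Hecke polynomial of `a^τ` vs. of `a_{π'}` (Lemma 5.2:
`τ y_w = y'_w`), and (b) with `σ ∈ Aut(ℂ/ℚ(a))` (GAPS pv01-G1e (i): `y_w = μ_w(ϖ_w)q_w^{1/2}` is fixed by every such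
`σ`).  Nothing about absolute values of `σ`-images is assumed.
-/

namespace HodgeCM
namespace PerL34
namespace SatakeConj

open Polynomial

/-- If an injective ring endomorphism `σ` of `ℂ` fixes (the coefficients of) `p ≠ 0`, it permutes the roots of `p`. -/
theorem mem_roots_of_map_eq (σ : ℂ →+* ℂ) (hσ : Function.Injective σ) {p : ℂ[X]} (hp : p.map σ = p)
    {z : ℂ} (hz : z ∈ p.roots) : σ z ∈ p.roots := by
  have hcard : p.roots.card = p.natDegree :=
    (Polynomial.Splits.natDegree_eq_card_roots (IsAlgClosed.splits p)).symm
  have h := Polynomial.roots_map_of_injective_of_card_eq_natDegree hσ hcard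
  rw [hp] at h
  rw [← h]
  exact Multiset.mem_map_of_mem σ hz

/-- **[Y1neg] (eq:satconj) + Lemma 5.2, vocabulary-free core.**  If `σ` fixes the Hecke polynomial `p` whose roots
are the Satake multiset `{x, y, y/q}` (`‖x‖ = 1`, `‖y‖ = q^{1/2}`, `q > 1` an integer), then `σ y = y`. -/
theorem fixes_middle_param (σ : ℂ →+* ℂ) (hσ : Function.Injective σ) {p : ℂ[X]} (hp : p.map σ = p)
    {q : ℕ} (hq : 1 < q) {x y : ℂ} (hx : ‖x‖ = 1) (hy : ‖y‖ = Real.sqrt q)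
    (hroots : p.roots = {x, y, y / q}) : σ y = y := by
  have hqR : (1 : ℝ) < (q : ℝ) := by exact_mod_cast hq
  -- membership of σ y and σ (y/q) = σ y / q in the root multiset
  have hyr : y ∈ p.roots := by rw [hroots]; simp
  have hyqr : y / (q : ℂ) ∈ p.roots := by rw [hroots]; simp
  have h1 : σ y ∈ p.roots := mem_roots_of_map_eq σ hσ hp hyr
  have h2 : σ y / (q : ℂ) ∈ p.roots := by
    have := mem_roots_of_map_eq σ hσ hp hyqr
    rwa [map_div₀, map_natCast] at this
  rw [hroots] at h1 h2
  have mem3 : ∀ {b : ℂ}, b ∈ ({x, y, y / (q : ℂ)} : Multiset ℂ) → b = x ∨ b = y ∨ b = y / (q : ℂ) := by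
    intro b hb
    simpa [Multiset.mem_cons, Multiset.mem_singleton] using hb
  have ha := mem3 h1
  have hb := mem3 h2
  -- rewrite the casts `((q : ℕ) : ℂ)` as `((q : ℝ) : ℂ)` to apply the multiset step
  have hcast : ((q : ℕ) : ℂ) = ((q : ℝ) : ℂ) := by push_cast; rfl
  rw [hcast] at ha hb
  have hy' : ‖y‖ = Real.sqrt (q : ℝ) := hy
  exact SatakeMultiset.eq_of_mem_of_div_mem hqR hx hy' ha hb

end SatakeConj
end PerL34
end HodgeCM
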